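import Summits.KontsevichZagierPeriods.KontsevichZagierPeriods.Theorems.RootDecompRationalCubeDichotomyArctanFibreP2

/-!
# Arctan-fibre calculus for `RationalCubePiKernelSingle` (route `RootDecompRationalCubeDichotomy`, crux stmt-KontsevichZagierPeriods-26322) at `m = 2` · part 3/9

Cell `decomp-kz`, lens 2 (decomp-kz-lens-2 g7): the GENERIC (arctan-fibre) side of the first open rung `m = 2` of
`RationalCubePiKernelSingle` decided INSIDE the Kontsevich–Zagier calculus with `N = 0`, by rules 1+2 only: fibred Möbius
charts `x ↦ x(q+r)/(q+rx)` (`MoebiusData.rel`), the TANGENT-ADDITION chart `x ↦ x(1−p)/(1−px²)` = the group law of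
`tan` as a move (`TanData.tan_add`), Serret's base involution `y ↦ (1−y)/(1+y)` (`rel_serret`), one moving-centre
dissection with null surgery (§8), odd-symmetry vanishing (§7b).  Decided census classes: `π·log 2` (`pilog2_rel`,
census pair #33), Catalan (`catalan_rel`, #32), dilogarithm classes `dilogA_rel` (#28), `dilogB_rel` (#30),
`dilogC_rel` (#24), seven moment relations; §9 the LITERAL binder instances of `RationalCubePiKernelSingle` at
`m = 2`, `N = 0` (the route decl is not referenced by name, so these modules do not import the route file);
§10 six UNIFORM CLASSES `single_classSwap/Reflect/Halve/Moebius/Serret/TanAdd`.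

Source: `HOME/decomp-kz-lens-2/g7/ArctanFibreCalculus.lean` sha256 964497cf335d1c59 (2144 l; critic decomp-kz-crit-1 g2
CLEARED 2026-08-30T09:13:02Z incl. transcription numerics, std axioms), split into 9 modules by the landing seat
decomp-kz-census-1 g7 (contexts re-opened per part; generic docstrings added where the source had none).
No `sorry`; standard axioms.  References: [cite: KontsevichZagier2001, §1.2]; J.-A. Serret (1844).
-/

noncomputable section

open Set MeasureTheory MvPolynomial
open Literature.ModelTheory.ExponentialFields (IsSemialgebraic)
open Literature.NumberTheory.Transcendental
open Literature.NumberTheory.Transcendental.KZ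
open Literature.NumberTheory.Transcendental.KZ.RFun
open Summit.KontsevichZagierPeriods.KontsevichZagierPeriods.Theorems

namespace Summit.KontsevichZagierPeriods.RootDecompRationalCubeDichotomy.ArctanFibre

-- PRIVATE copy (landed twin elsewhere / dedup.landed): mem_cube_two, vec_mem_cube_two, snoc_two_zero, snoc_two_one, init_apply_zero, vec_zero, vec_one
/-- `mem_cube_two`: auxiliary theorem of the arctan-fibre calculus for `RationalCubePiKernelSingle` (stmt-26322) — see the module docstring; verbatim from the lens file. -/
private theorem mem_cube_two {z : Fin 2 → ℝ} (hz : z ∈ KZ.cube 2) :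
    (0 ≤ z 0 ∧ z 0 ≤ 1) ∧ (0 ≤ z 1 ∧ z 1 ≤ 1) := ⟨hz 0, hz 1⟩

/-- Points of the square given by two coordinates in `[0,1]`. -/
private theorem vec_mem_cube_two {a b : ℝ} (ha : 0 ≤ a ∧ a ≤ 1) (hb : 0 ≤ b ∧ b ≤ 1) :
    (![a, b] : Fin 2 → ℝ) ∈ KZ.cube 2 := by
  intro i; fin_cases i
  · exact ha
  · exact hb

/-- `snoc_two_zero`: auxiliary theorem of the arctan-fibre calculus for `RationalCubePiKernelSingle` (stmt-26322) — see the module docstring; verbatim from the lens file. -/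
@[simp] private theorem snoc_two_zero (y : Fin 1 → ℝ) (s : ℝ) : (Fin.snoc y s : Fin 2 → ℝ) 0 = y 0 := rfl

/-- `snoc_two_one`: auxiliary theorem of the arctan-fibre calculus for `RationalCubePiKernelSingle` (stmt-26322) — see the module docstring; verbatim from the lens file. -/
@[simp] private theorem snoc_two_one (y : Fin 1 → ℝ) (s : ℝ) : (Fin.snoc y s : Fin 2 → ℝ) 1 = s := rfl

/-- `init_apply_zero`: auxiliary theorem of the arctan-fibre calculus for `RationalCubePiKernelSingle` (stmt-26322) — see the module docstring; verbatim from the lens file. -/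
@[simp] private theorem init_apply_zero (z : Fin 2 → ℝ) : Fin.init z 0 = z 0 := rfl

/-- `vec_zero`: auxiliary theorem of the arctan-fibre calculus for `RationalCubePiKernelSingle` (stmt-26322) — see the module docstring; verbatim from the lens file. -/
@[simp] private theorem vec_zero (a b : ℝ) : (![a, b] : Fin 2 → ℝ) 0 = a := rfl

/-- `vec_one`: auxiliary theorem of the arctan-fibre calculus for `RationalCubePiKernelSingle` (stmt-26322) — see the module docstring; verbatim from the lens file. -/
@[simp] private theorem vec_one (a b : ℝ) : (![a, b] : Fin 2 → ℝ) 1 = b := rfl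

/-- Serret's involution of `[0,1]`. -/
def serret (t : ℝ) : ℝ := (1 - t) / (1 + t)

/-- `serret_one_sub`: auxiliary theorem of the arctan-fibre calculus for `RationalCubePiKernelSingle` (stmt-26322) — see the module docstring; verbatim from the lens file. -/
theorem serret_one_sub (t : ℝ) : serret (1 - t) = t / (2 - t) := by
  unfold serret; congr 1 <;> ring

/-- `serret_mem`: auxiliary theorem of the arctan-fibre calculus for `RationalCubePiKernelSingle` (stmt-26322) — see the module docstring; verbatim from the lens file. -/
theorem serret_mem {t : ℝ} (ht : 0 ≤ t ∧ t ≤ 1) : 0 ≤ serret t ∧ serret t ≤ 1 := by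
  unfold serret
  have h1 : 0 < 1 + t := by linarith
  exact ⟨div_nonneg (by linarith) h1.le, (div_le_one h1).mpr (by linarith)⟩

/-- The Möbius data of the chart `y ↦ y/(2 − y)` (`q = 2`, `r = −1`). -/
def serretData : MoebiusData where
  Q := C 2
  R := -1
  hQ := fun t _ => by simp
  hQR := fun t _ => by norm_num [pv_neg, pv_one, pv_C]

/-- `serretData_q`: auxiliary theorem of the arctan-fibre calculus for `RationalCubePiKernelSingle` (stmt-26322) — see the module docstring; verbatim from the lens file. -/
@[simp] theorem serretData_q (t : ℝ) : serretData.q t = 2 := by simp [MoebiusData.q, serretData]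
/-- `serretData_r`: auxiliary theorem of the arctan-fibre calculus for `RationalCubePiKernelSingle` (stmt-26322) — see the module docstring; verbatim from the lens file. -/
@[simp] theorem serretData_r (t : ℝ) : serretData.r t = -1 := by simp [MoebiusData.r, serretData]

/-- **Serret move.**  If `F(y, x) = G((1−y)/(1+y), x) · 2/(1+y)²` on the square then `[F] ≡ [G]`:
the base substitution `y ↦ (1−y)/(1+y)`, realised as swap ∘ (reflection `y ↦ 1−y`) ∘
(Möbius chart `y ↦ y/(2−y)`) ∘ swap. -/
theorem rel_serret (F G : RFun 2)
    (h : ∀ z ∈ KZ.cube 2, F.fn z = G.fn ![serret (z 0), z 1] * (2 / (1 + z 0) ^ 2)) :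
    KZ.of F.rep - KZ.of G.rep ∈ KZ.relations := by
  -- `Fr(x, y) = F(1 − y, x)` is the Möbius image of `Gs(x, u) = G(u, x)`
  have hmob : KZ.of (reflect 1 (swap F)).rep - KZ.of (swap G).rep ∈ KZ.relations := by
    refine serretData.rel _ _ fun z hz => ?_
    have h01 := mem_cube_two hz
    have hpt : (![1 - z 1, z 0] : Fin 2 → ℝ) ∈ KZ.cube 2 :=
      vec_mem_cube_two ⟨by linarith [h01.2.2], by linarith [h01.2.1]⟩ h01.1
    rw [fn_reflect_one, fn_swap, vec_zero, vec_one, h _ hpt, vec_zero, vec_one, serret_one_sub,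
      fn_swap, vec_zero, vec_one]
    simp only [serretData_q, serretData_r]
    have h2 : (2 : ℝ) - z 1 ≠ 0 := by linarith [h01.2.2]
    have e1 : z 1 * (2 + -1) / (2 + -1 * z 1) = z 1 / (2 - z 1) := by
      rw [div_eq_div_iff (by linarith [h01.2.2]) h2]; ring
    have e2 : (2 + -1) * 2 / (2 + -1 * z 1) ^ 2 = 2 / (1 + (1 - z 1)) ^ 2 := by
      rw [div_eq_div_iff (by nlinarith) (by nlinarith)]; ring
    rw [e1, e2]
  have h1 := rel_swap F
  have h2 := rel_reflect 1 (swap F)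
  have h3 := rel_swap G
  have := sub_mem (add_mem (sub_mem h1 h2) hmob) h3
  convert this using 1
  abel

/-! ## 5. The objects: arctangent densities `w a/(1 + a²x²)` and the census integrands

Coordinates: `y = z 0` is the base, `x = z 1` the fibre (the census `K-CUBEBOX-M2` writes its
denominators as `c₀₀ + c₁₀x + c₀₁y + c₂₀x² + c₁₁xy + c₀₂y²` with the same letters `x, y`). -/

section Objects

/-- `p0_ne`: auxiliary theorem of the arctan-fibre calculus for `RationalCubePiKernelSingle` (stmt-26322) — see the module docstring; verbatim from the lens file. -/
theorem p0_ne : ∀ z ∈ KZ.cube 2, aeval z ((1 + X 1 ^ 2) * (1 + X 0) : MvPolynomial (Fin 2) ℚ) ≠ 0 := by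
  intro z hz
  obtain ⟨⟨hy0, hy1⟩, hx0, hx1⟩ := mem_cube_two hz
  have hy1' : (0 : ℝ) ≤ 1 - z 0 := by linarith
  have hx1' : (0 : ℝ) ≤ 1 - z 1 := by linarith
  have h : aeval z ((1 + X 1 ^ 2) * (1 + X 0) : MvPolynomial (Fin 2) ℚ) = ((1 + z 1 ^ 2) * (1 + z 0)) := by simp
  rw [h]
  have hp : (0 : ℝ) < ((1 + z 1 ^ 2) * (1 + z 0)) := by positivity
  exact hp.ne'

/-- `p₀ = [□, 1/((1+x²)(1+y))]` (`= π log 2/4`). -/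
def p0 : RFun 2 := ⟨1, (1 + X 1 ^ 2) * (1 + X 0), p0_ne⟩

/-- `p0_fn`: auxiliary theorem of the arctan-fibre calculus for `RationalCubePiKernelSingle` (stmt-26322) — see the module docstring; verbatim from the lens file. -/
theorem p0_fn (z : Fin 2 → ℝ) : p0.fn z = 1 / ((1 + z 1 ^ 2) * (1 + z 0)) := by
  simp [p0, fn_apply]

/-- `p0_pos`: auxiliary theorem of the arctan-fibre calculus for `RationalCubePiKernelSingle` (stmt-26322) — see the module docstring; verbatim from the lens file. -/
theorem p0_pos {z : Fin 2 → ℝ} (hz : z ∈ KZ.cube 2) : (0 : ℝ) < ((1 + z 1 ^ 2) * (1 + z 0)) := by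
  obtain ⟨⟨hy0, hy1⟩, hx0, hx1⟩ := mem_cube_two hz
  have hy1' : (0 : ℝ) ≤ 1 - z 0 := by linarith
  have hx1' : (0 : ℝ) ≤ 1 - z 1 := by linarith
  positivity

/-- `J2_ne`: auxiliary theorem of the arctan-fibre calculus for `RationalCubePiKernelSingle` (stmt-26322) — see the module docstring; verbatim from the lens file. -/
theorem J2_ne : ∀ z ∈ KZ.cube 2, aeval z ((1 + X 0) * ((2 + X 0) ^ 2 + X 1 ^ 2) : MvPolynomial (Fin 2) ℚ) ≠ 0 := by
  intro z hz
  obtain ⟨⟨hy0, hy1⟩, hx0, hx1⟩ := mem_cube_two hz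
  have hy1' : (0 : ℝ) ≤ 1 - z 0 := by linarith
  have hx1' : (0 : ℝ) ≤ 1 - z 1 := by linarith
  have h : aeval z ((1 + X 0) * ((2 + X 0) ^ 2 + X 1 ^ 2) : MvPolynomial (Fin 2) ℚ) = ((1 + z 0) * ((2 + z 0) ^ 2 + z 1 ^ 2)) := by simp
  rw [h]
  have hp : (0 : ℝ) < ((1 + z 0) * ((2 + z 0) ^ 2 + z 1 ^ 2)) := by positivity
  exact hp.ne'

/-- `J₂ = [□, (2+y)/((1+y)((2+y)²+x²))]` (density `w a/(1+a²x²)`, `w = 1/(1+y)`, `a = 1/(2+y)`; `= π log 2/8`). -/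
def J2 : RFun 2 := ⟨2 + X 0, (1 + X 0) * ((2 + X 0) ^ 2 + X 1 ^ 2), J2_ne⟩

/-- `J2_fn`: auxiliary theorem of the arctan-fibre calculus for `RationalCubePiKernelSingle` (stmt-26322) — see the module docstring; verbatim from the lens file. -/
theorem J2_fn (z : Fin 2 → ℝ) : J2.fn z = (2 + z 0) / ((1 + z 0) * ((2 + z 0) ^ 2 + z 1 ^ 2)) := by
  simp [J2, fn_apply]

/-- `J2_pos`: auxiliary theorem of the arctan-fibre calculus for `RationalCubePiKernelSingle` (stmt-26322) — see the module docstring; verbatim from the lens file. -/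
theorem J2_pos {z : Fin 2 → ℝ} (hz : z ∈ KZ.cube 2) : (0 : ℝ) < ((1 + z 0) * ((2 + z 0) ^ 2 + z 1 ^ 2)) := by
  obtain ⟨⟨hy0, hy1⟩, hx0, hx1⟩ := mem_cube_two hz
  have hy1' : (0 : ℝ) ≤ 1 - z 0 := by linarith
  have hx1' : (0 : ℝ) ≤ 1 - z 1 := by linarith
  positivity

/-- `Nn_ne`: auxiliary theorem of the arctan-fibre calculus for `RationalCubePiKernelSingle` (stmt-26322) — see the module docstring; verbatim from the lens file. -/
theorem Nn_ne : ∀ z ∈ KZ.cube 2, aeval z ((3 + X 0) ^ 2 + (1 + X 0) ^ 2 * X 1 ^ 2 : MvPolynomial (Fin 2) ℚ) ≠ 0 := by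
  intro z hz
  obtain ⟨⟨hy0, hy1⟩, hx0, hx1⟩ := mem_cube_two hz
  have hy1' : (0 : ℝ) ≤ 1 - z 0 := by linarith
  have hx1' : (0 : ℝ) ≤ 1 - z 1 := by linarith
  have h : aeval z ((3 + X 0) ^ 2 + (1 + X 0) ^ 2 * X 1 ^ 2 : MvPolynomial (Fin 2) ℚ) = ((3 + z 0) ^ 2 + (1 + z 0) ^ 2 * z 1 ^ 2) := by simp
  rw [h]
  have hp : (0 : ℝ) < ((3 + z 0) ^ 2 + (1 + z 0) ^ 2 * z 1 ^ 2) := by positivity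
  exact hp.ne'

/-- `N = [□, (3+y)/((3+y)²+(1+y)²x²)]` (`w = 1/(1+y)`, `a = (1+y)/(3+y)`). -/
def Nn : RFun 2 := ⟨3 + X 0, (3 + X 0) ^ 2 + (1 + X 0) ^ 2 * X 1 ^ 2, Nn_ne⟩

/-- `Nn_fn`: auxiliary theorem of the arctan-fibre calculus for `RationalCubePiKernelSingle` (stmt-26322) — see the module docstring; verbatim from the lens file. -/
theorem Nn_fn (z : Fin 2 → ℝ) : Nn.fn z = (3 + z 0) / ((3 + z 0) ^ 2 + (1 + z 0) ^ 2 * z 1 ^ 2) := by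
  simp [Nn, fn_apply]

/-- `Nn_pos`: auxiliary theorem of the arctan-fibre calculus for `RationalCubePiKernelSingle` (stmt-26322) — see the module docstring; verbatim from the lens file. -/
theorem Nn_pos {z : Fin 2 → ℝ} (hz : z ∈ KZ.cube 2) : (0 : ℝ) < ((3 + z 0) ^ 2 + (1 + z 0) ^ 2 * z 1 ^ 2) := by
  obtain ⟨⟨hy0, hy1⟩, hx0, hx1⟩ := mem_cube_two hz
  have hy1' : (0 : ℝ) ≤ 1 - z 0 := by linarith
  have hx1' : (0 : ℝ) ≤ 1 - z 1 := by linarith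
  positivity

/-- `J1_ne`: auxiliary theorem of the arctan-fibre calculus for `RationalCubePiKernelSingle` (stmt-26322) — see the module docstring; verbatim from the lens file. -/
theorem J1_ne : ∀ z ∈ KZ.cube 2, aeval z ((1 + X 0) * (1 + X 0 ^ 2 * X 1 ^ 2) : MvPolynomial (Fin 2) ℚ) ≠ 0 := by
  intro z hz
  obtain ⟨⟨hy0, hy1⟩, hx0, hx1⟩ := mem_cube_two hz
  have hy1' : (0 : ℝ) ≤ 1 - z 0 := by linarith
  have hx1' : (0 : ℝ) ≤ 1 - z 1 := by linarith
  have h : aeval z ((1 + X 0) * (1 + X 0 ^ 2 * X 1 ^ 2) : MvPolynomial (Fin 2) ℚ) = ((1 + z 0) * (1 + z 0 ^ 2 * z 1 ^ 2)) := by simp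
  rw [h]
  have hp : (0 : ℝ) < ((1 + z 0) * (1 + z 0 ^ 2 * z 1 ^ 2)) := by positivity
  exact hp.ne'

/-- `J₁ = [□, y/((1+y)(1+y²x²))]` (`w = 1/(1+y)`, `a = y`). -/
def J1 : RFun 2 := ⟨X 0, (1 + X 0) * (1 + X 0 ^ 2 * X 1 ^ 2), J1_ne⟩

/-- `J1_fn`: auxiliary theorem of the arctan-fibre calculus for `RationalCubePiKernelSingle` (stmt-26322) — see the module docstring; verbatim from the lens file. -/
theorem J1_fn (z : Fin 2 → ℝ) : J1.fn z = z 0 / ((1 + z 0) * (1 + z 0 ^ 2 * z 1 ^ 2)) := by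
  simp [J1, fn_apply]

/-- `J1_pos`: auxiliary theorem of the arctan-fibre calculus for `RationalCubePiKernelSingle` (stmt-26322) — see the module docstring; verbatim from the lens file. -/
theorem J1_pos {z : Fin 2 → ℝ} (hz : z ∈ KZ.cube 2) : (0 : ℝ) < ((1 + z 0) * (1 + z 0 ^ 2 * z 1 ^ 2)) := by
  obtain ⟨⟨hy0, hy1⟩, hx0, hx1⟩ := mem_cube_two hz
  have hy1' : (0 : ℝ) ≤ 1 - z 0 := by linarith
  have hx1' : (0 : ℝ) ≤ 1 - z 1 := by linarith
  positivity

/-- `J1p_ne`: auxiliary theorem of the arctan-fibre calculus for `RationalCubePiKernelSingle` (stmt-26322) — see the module docstring; verbatim from the lens file. -/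
theorem J1p_ne : ∀ z ∈ KZ.cube 2, aeval z ((1 + X 0) ^ 2 + (1 - X 0) ^ 2 * X 1 ^ 2 : MvPolynomial (Fin 2) ℚ) ≠ 0 := by
  intro z hz
  obtain ⟨⟨hy0, hy1⟩, hx0, hx1⟩ := mem_cube_two hz
  have hy1' : (0 : ℝ) ≤ 1 - z 0 := by linarith
  have hx1' : (0 : ℝ) ≤ 1 - z 1 := by linarith
  have h : aeval z ((1 + X 0) ^ 2 + (1 - X 0) ^ 2 * X 1 ^ 2 : MvPolynomial (Fin 2) ℚ) = ((1 + z 0) ^ 2 + (1 - z 0) ^ 2 * z 1 ^ 2) := by simp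
  rw [h]
  have hp : (0 : ℝ) < ((1 + z 0) ^ 2 + (1 - z 0) ^ 2 * z 1 ^ 2) := by positivity
  exact hp.ne'

/-- `J₁' = [□, (1−y)/((1+y)²+(1−y)²x²)]` (`w = 1/(1+y)`, `a = (1−y)/(1+y)`). -/
def J1p : RFun 2 := ⟨1 - X 0, (1 + X 0) ^ 2 + (1 - X 0) ^ 2 * X 1 ^ 2, J1p_ne⟩

/-- `J1p_fn`: auxiliary theorem of the arctan-fibre calculus for `RationalCubePiKernelSingle` (stmt-26322) — see the module docstring; verbatim from the lens file. -/
theorem J1p_fn (z : Fin 2 → ℝ) : J1p.fn z = (1 - z 0) / ((1 + z 0) ^ 2 + (1 - z 0) ^ 2 * z 1 ^ 2) := by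
  simp [J1p, fn_apply]

/-- `J1p_pos`: auxiliary theorem of the arctan-fibre calculus for `RationalCubePiKernelSingle` (stmt-26322) — see the module docstring; verbatim from the lens file. -/
theorem J1p_pos {z : Fin 2 → ℝ} (hz : z ∈ KZ.cube 2) : (0 : ℝ) < ((1 + z 0) ^ 2 + (1 - z 0) ^ 2 * z 1 ^ 2) := by
  obtain ⟨⟨hy0, hy1⟩, hx0, hx1⟩ := mem_cube_two hz
  have hy1' : (0 : ℝ) ≤ 1 - z 0 := by linarith
  have hx1' : (0 : ℝ) ≤ 1 - z 1 := by linarith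
  positivity

/-- `cBst_ne`: auxiliary theorem of the arctan-fibre calculus for `RationalCubePiKernelSingle` (stmt-26322) — see the module docstring; verbatim from the lens file. -/
theorem cBst_ne : ∀ z ∈ KZ.cube 2, aeval z ((1 + X 0 + X 1) ^ 2 + X 1 ^ 2 : MvPolynomial (Fin 2) ℚ) ≠ 0 := by
  intro z hz
  obtain ⟨⟨hy0, hy1⟩, hx0, hx1⟩ := mem_cube_two hz
  have hy1' : (0 : ℝ) ≤ 1 - z 0 := by linarith
  have hx1' : (0 : ℝ) ≤ 1 - z 1 := by linarith
  have h : aeval z ((1 + X 0 + X 1) ^ 2 + X 1 ^ 2 : MvPolynomial (Fin 2) ℚ) = ((1 + z 0 + z 1) ^ 2 + z 1 ^ 2) := by simp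
  rw [h]
  have hp : (0 : ℝ) < ((1 + z 0 + z 1) ^ 2 + z 1 ^ 2) := by positivity
  exact hp.ne'

/-- `B* = [□, 1/((1+y+x)²+x²)]` — the census integrand `B` with `x ↔ y`. -/
def cBst : RFun 2 := ⟨1, (1 + X 0 + X 1) ^ 2 + X 1 ^ 2, cBst_ne⟩

/-- `cBst_fn`: auxiliary theorem of the arctan-fibre calculus for `RationalCubePiKernelSingle` (stmt-26322) — see the module docstring; verbatim from the lens file. -/
theorem cBst_fn (z : Fin 2 → ℝ) : cBst.fn z = 1 / ((1 + z 0 + z 1) ^ 2 + z 1 ^ 2) := by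
  simp [cBst, fn_apply]

/-- `cBst_pos`: auxiliary theorem of the arctan-fibre calculus for `RationalCubePiKernelSingle` (stmt-26322) — see the module docstring; verbatim from the lens file. -/
theorem cBst_pos {z : Fin 2 → ℝ} (hz : z ∈ KZ.cube 2) : (0 : ℝ) < ((1 + z 0 + z 1) ^ 2 + z 1 ^ 2) := by
  obtain ⟨⟨hy0, hy1⟩, hx0, hx1⟩ := mem_cube_two hz
  have hy1' : (0 : ℝ) ≤ 1 - z 0 := by linarith
  have hx1' : (0 : ℝ) ≤ 1 - z 1 := by linarith
  positivity

/-- `cBcen_ne`: auxiliary theorem of the arctan-fibre calculus for `RationalCubePiKernelSingle` (stmt-26322) — see the module docstring; verbatim from the lens file. -/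
theorem cBcen_ne : ∀ z ∈ KZ.cube 2, aeval z (1 + 2 * X 1 + 2 * X 0 + X 1 ^ 2 + 2 * X 1 * X 0 + 2 * X 0 ^ 2 : MvPolynomial (Fin 2) ℚ) ≠ 0 := by
  intro z hz
  obtain ⟨⟨hy0, hy1⟩, hx0, hx1⟩ := mem_cube_two hz
  have hy1' : (0 : ℝ) ≤ 1 - z 0 := by linarith
  have hx1' : (0 : ℝ) ≤ 1 - z 1 := by linarith
  have h : aeval z (1 + 2 * X 1 + 2 * X 0 + X 1 ^ 2 + 2 * X 1 * X 0 + 2 * X 0 ^ 2 : MvPolynomial (Fin 2) ℚ) = (1 + 2 * z 1 + 2 * z 0 + z 1 ^ 2 + 2 * z 1 * z 0 + 2 * z 0 ^ 2) := by simp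
  rw [h]
  have hp : (0 : ℝ) < (1 + 2 * z 1 + 2 * z 0 + z 1 ^ 2 + 2 * z 1 * z 0 + 2 * z 0 ^ 2) := by positivity
  exact hp.ne'

/-- `B = [□, 1/(1+2x+2y+x²+2xy+2y²)]` (census `K-CUBEBOX-M2` tuple `[1,2,2,1,2,2]`, value `π log 2/8`). -/
def cBcen : RFun 2 := ⟨1, 1 + 2 * X 1 + 2 * X 0 + X 1 ^ 2 + 2 * X 1 * X 0 + 2 * X 0 ^ 2, cBcen_ne⟩

/-- `cBcen_fn`: auxiliary theorem of the arctan-fibre calculus for `RationalCubePiKernelSingle` (stmt-26322) — see the module docstring; verbatim from the lens file. -/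
theorem cBcen_fn (z : Fin 2 → ℝ) : cBcen.fn z = 1 / (1 + 2 * z 1 + 2 * z 0 + z 1 ^ 2 + 2 * z 1 * z 0 + 2 * z 0 ^ 2) := by
  simp [cBcen, fn_apply]

/-- `cBcen_pos`: auxiliary theorem of the arctan-fibre calculus for `RationalCubePiKernelSingle` (stmt-26322) — see the module docstring; verbatim from the lens file. -/
theorem cBcen_pos {z : Fin 2 → ℝ} (hz : z ∈ KZ.cube 2) : (0 : ℝ) < (1 + 2 * z 1 + 2 * z 0 + z 1 ^ 2 + 2 * z 1 * z 0 + 2 * z 0 ^ 2) := by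
  obtain ⟨⟨hy0, hy1⟩, hx0, hx1⟩ := mem_cube_two hz
  have hy1' : (0 : ℝ) ≤ 1 - z 0 := by linarith
  have hx1' : (0 : ℝ) ≤ 1 - z 1 := by linarith
  positivity

/-- `cA_ne`: auxiliary theorem of the arctan-fibre calculus for `RationalCubePiKernelSingle` (stmt-26322) — see the module docstring; verbatim from the lens file. -/
theorem cA_ne : ∀ z ∈ KZ.cube 2, aeval z (1 - 2 * X 1 + 2 * X 1 ^ 2 + 2 * X 1 * X 0 + X 0 ^ 2 : MvPolynomial (Fin 2) ℚ) ≠ 0 := by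
  intro z hz
  obtain ⟨⟨hy0, hy1⟩, hx0, hx1⟩ := mem_cube_two hz
  have hy1' : (0 : ℝ) ≤ 1 - z 0 := by linarith
  have hx1' : (0 : ℝ) ≤ 1 - z 1 := by linarith
  have h : aeval z (1 - 2 * X 1 + 2 * X 1 ^ 2 + 2 * X 1 * X 0 + X 0 ^ 2 : MvPolynomial (Fin 2) ℚ) = (1 - 2 * z 1 + 2 * z 1 ^ 2 + 2 * z 1 * z 0 + z 0 ^ 2) := by simp
  rw [h]
  have hp : (0 : ℝ) < (1 - 2 * z 1 + 2 * z 1 ^ 2 + 2 * z 1 * z 0 + z 0 ^ 2) := by nlinarith [mul_nonneg hx0 hy0, mul_nonneg hx0 hx1', mul_nonneg hy0 hy1', mul_nonneg hx1' hy1', sq_nonneg (2 * z 1 - 1), sq_nonneg (2 * z 0 - 1)]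
  exact hp.ne'

/-- `A = [□, 1/(1−2x+2x²+2xy+y²)]` (census tuple `[1,-2,0,2,2,1]`, value `3π log 2/8`). -/
def cA : RFun 2 := ⟨1, 1 - 2 * X 1 + 2 * X 1 ^ 2 + 2 * X 1 * X 0 + X 0 ^ 2, cA_ne⟩

/-- `cA_fn`: auxiliary theorem of the arctan-fibre calculus for `RationalCubePiKernelSingle` (stmt-26322) — see the module docstring; verbatim from the lens file. -/
theorem cA_fn (z : Fin 2 → ℝ) : cA.fn z = 1 / (1 - 2 * z 1 + 2 * z 1 ^ 2 + 2 * z 1 * z 0 + z 0 ^ 2) := by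
  simp [cA, fn_apply]

/-- `cA_pos`: auxiliary theorem of the arctan-fibre calculus for `RationalCubePiKernelSingle` (stmt-26322) — see the module docstring; verbatim from the lens file. -/
theorem cA_pos {z : Fin 2 → ℝ} (hz : z ∈ KZ.cube 2) : (0 : ℝ) < (1 - 2 * z 1 + 2 * z 1 ^ 2 + 2 * z 1 * z 0 + z 0 ^ 2) := by
  obtain ⟨⟨hy0, hy1⟩, hx0, hx1⟩ := mem_cube_two hz
  have hy1' : (0 : ℝ) ≤ 1 - z 0 := by linarith
  have hx1' : (0 : ℝ) ≤ 1 - z 1 := by linarith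
  nlinarith [mul_nonneg hx0 hy0, mul_nonneg hx0 hx1', mul_nonneg hy0 hy1', mul_nonneg hx1' hy1', sq_nonneg (2 * z 1 - 1), sq_nonneg (2 * z 0 - 1)]

end Objects

end Summit.KontsevichZagierPeriods.RootDecompRationalCubeDichotomy.ArctanFibre

end
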